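import Summits.CriticalPhenomena.SAWScalingLimit.Theorems.SAWTotalPositivityBoundaryTP2Defs
import Summits.CriticalPhenomena.SAWScalingLimit.Theorems.SAWTotalPositivityBoundaryTP2Kernel
import Summits.CriticalPhenomena.SAWScalingLimit.Theorems.SAWTotalPositivityBoundaryTP2Symmetry
import Summits.CriticalPhenomena.SAWScalingLimit.Theorems.EdgeOfPositivity.Negative.EdgeOfPositivityRectDomain
import HarnessLib

/-!
# Crux `BoundaryTP2` (stmt-CriticalPhenomena-7115), line `Sketch`: stub `stub_ladder_alternate`

Tool stub of the line's skeleton: on the ladder `R_L = discreteDomainGraph (rectDomain L 1) 1`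
(sites `{0..L} × {0,1}`) every site lies on the boundary cycle
`(0,0) → (1,0) → ⋯ → (L,0) → (L,1) → (L-1,1) → ⋯ → (0,1) → (0,0)`, indexed counter-clockwise by the
POSITION `pos (c,0) = c`, `pos (c,1) = 2L+1-c` (a bijection onto `{0,…,2L+1}`; consecutive positions,
and the two ends `2L+1`, `0`, are adjacent sites). If four pairwise distinct sites `p₁, p₂, p₃, p₄` of
the ladder are interlaced (every self-avoiding path `p₁ → p₃` meets every self-avoiding path
`p₂ → p₄`), then the pairs `{p₁,p₃}`, `{p₂,p₄}` alternate around the cycle: exactly one of `pos p₂`,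
`pos p₄` lies strictly between `m = min (pos p₁) (pos p₃)` and `M = max (pos p₁) (pos p₃)`.

Proof (constructive contrapositive). Boundary arcs are walks of `R_L` with position-controlled
supports: the direct arc between two sites visits exactly the positions between theirs
(`exists_arcWalk`: a run of the bottom row / bottom row, right rung, top row leftwards / a run of the
top row), and the arc through the left rung `(0,1) — (0,0)` visits only positions above its start or
below its end (`exists_wrapWalk`). If both `pos p₂`, `pos p₄` are strictly between `m` and `M`, the
wrap-around arc `p₁ → p₃` (positions `≥ M` or `≤ m`) and the direct arc `p₂ → p₄` (positions inside
`(m, M)`) have disjoint supports; if neither is (so both lie outside `[m, M]`, positions being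
pairwise distinct), the direct arc `p₁ → p₃` (positions in `[m, M]`) and an arc `p₂ → p₄` inside the
complement (direct if `p₂`, `p₄` are on the same side, through the left rung otherwise) have disjoint
supports. Shortening the two walks to self-avoiding paths (`SimpleGraph.Walk.toPath`, supports only
shrink) contradicts interlacing.
-/

noncomputable section

namespace Summit.CriticalPhenomena.SAWScalingLimit.Theorems.BoundaryTP2

open Literature.Probability.LatticeModels Literature.Probability.RandomPlanarGeometry
open Summit.CriticalPhenomena.SAWScalingLimit.Theorems.EdgeOfPositivity.Negative

/-! ### Edges and straight runs of the ladder -/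

/-- The horizontal segment `{c..c'} × {j}` of the ladder (`0 ≤ j ≤ 1`, `0 ≤ c ≤ c' ≤ L`) carries a walk
of the ladder graph from `(c,j)` rightwards to `(c',j)` all of whose vertices lie on that segment.
[folklore] -/
private theorem exists_ladderRowWalk (L : ℕ) {j c c' : ℤ} (hj0 : 0 ≤ j) (hj1 : j ≤ 1) (hc : 0 ≤ c)
    (hcc' : c ≤ c') (hc' : c' ≤ L) :
    ∃ W : (discreteDomainGraph (rectDomain L 1) 1).Walk (st c j) (st c' j),
      ∀ z ∈ W.support, z 1 = j ∧ c ≤ z 0 ∧ z 0 ≤ c' := by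
  -- adapted from `exists_boxColWalk` in `…BoundaryTP2RectFacingPairs`
  induction c', hcc' using Int.leInduction with
  | base =>
    refine ⟨SimpleGraph.Walk.nil, fun z hz => ?_⟩
    rw [SimpleGraph.Walk.support_nil, List.mem_singleton] at hz
    subst hz
    rw [st_zero, st_one]
    exact ⟨rfl, le_rfl, le_rfl⟩
  | succ n hmn ih =>
    obtain ⟨W, hW⟩ := ih (by omega)
    have hadj : (discreteDomainGraph (rectDomain L 1) 1).Adj (st n j) (st (n + 1) j) := by
      refine adj_rect_iff.2 ⟨zdGraph_adj_st_succ_left n j, ?_, ?_⟩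
      · rw [mem_rectSites_iff, st_zero, st_one]; omega
      · rw [mem_rectSites_iff, st_zero, st_one]; omega
    refine ⟨W.concat hadj, fun z hz => ?_⟩
    rw [SimpleGraph.Walk.support_concat, List.mem_append, List.mem_singleton] at hz
    rcases hz with hz | rfl
    · have := hW z hz
      omega
    · rw [st_zero, st_one]
      omega

/-- The rung `(c,0) — (c,1)` at a column `0 ≤ c ≤ L` is an edge of the ladder graph. [folklore] -/
private theorem ladder_rung_adj (L : ℕ) {c : ℤ} (hc : 0 ≤ c) (hcL : c ≤ L) :
    (discreteDomainGraph (rectDomain L 1) 1).Adj (st c 0) (st c 1) := by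
  refine adj_rect_iff.2 ⟨?_, ?_, ?_⟩
  · have := zdGraph_adj_st_succ_right c 0
    rwa [zero_add] at this
  · rw [mem_rectSites_iff, st_zero, st_one]; omega
  · rw [mem_rectSites_iff, st_zero, st_one]; omega

/-! ### Positions along the boundary cycle -/

/-- Two sites of `ℤ²` with the same two coordinates are equal. [folklore] -/
private theorem site_eq_of_coord_eq {u v : Site 2} (h0 : u 0 = v 0) (h1 : u 1 = v 1) : u = v :=
  calc u = st (u 0) (u 1) := (st_eta u).symm
    _ = st (v 0) (v 1) := by rw [h0, h1]
    _ = v := st_eta v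

/-- A ladder site is on the bottom row, at position its column `c ∈ [0, L]`, or on the top row, at
position `2L+1-c`. [folklore] -/
private theorem pos_cases (L : ℕ) {pos : Site 2 → ℤ}
    (hpos : ∀ p, pos p = if p 1 = 0 then p 0 else 2 * L + 1 - p 0) {u : Site 2}
    (hu : u ∈ rectSites L 1) :
    (u 1 = 0 ∧ pos u = u 0 ∧ 0 ≤ u 0 ∧ u 0 ≤ L) ∨
      (u 1 = 1 ∧ pos u = 2 * L + 1 - u 0 ∧ 0 ≤ u 0 ∧ u 0 ≤ L) := by
  rw [mem_rectSites_iff] at hu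
  rcases (by omega : u 1 = 0 ∨ u 1 = 1) with h | h
  · exact Or.inl ⟨h, by rw [hpos, if_pos h], hu.1.1, hu.1.2⟩
  · exact Or.inr ⟨h, by rw [hpos, if_neg (by omega)], hu.1.1, hu.1.2⟩

/-- The position determines the ladder site (`pos` is injective on the ladder). [folklore] -/
private theorem eq_of_pos_eq (L : ℕ) {pos : Site 2 → ℤ}
    (hpos : ∀ p, pos p = if p 1 = 0 then p 0 else 2 * L + 1 - p 0) {u v : Site 2}
    (hu : u ∈ rectSites L 1) (hv : v ∈ rectSites L 1) (h : pos u = pos v) : u = v := by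
  rcases pos_cases L hpos hu with ⟨hu1, hpu, hu0, hu0'⟩ | ⟨hu1, hpu, hu0, hu0'⟩ <;>
  rcases pos_cases L hpos hv with ⟨hv1, hpv, hv0, hv0'⟩ | ⟨hv1, hpv, hv0, hv0'⟩ <;>
  exact site_eq_of_coord_eq (by omega) (by omega)

/-! ### Boundary arcs with position-controlled supports -/

/-- **Direct boundary arc.** For ladder sites `u`, `v` with `pos u ≤ pos v` there is a walk of the
ladder graph from `u` to `v` visiting only sites with position in `[pos u, pos v]`: a run of the bottom
row; or a run of the bottom row to `(L,0)`, the right rung and a run of the top row leftwards; or a run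
of the top row leftwards. [folklore] -/
private theorem exists_arcWalk (L : ℕ) {pos : Site 2 → ℤ}
    (hpos : ∀ p, pos p = if p 1 = 0 then p 0 else 2 * L + 1 - p 0) {u v : Site 2}
    (hu : u ∈ rectSites L 1) (hv : v ∈ rectSites L 1) (huv : pos u ≤ pos v) :
    ∃ W : (discreteDomainGraph (rectDomain L 1) 1).Walk u v,
      ∀ z ∈ W.support, pos u ≤ pos z ∧ pos z ≤ pos v := by
  rcases pos_cases L hpos hu with ⟨hu1, hpu, hu0, hu0'⟩ | ⟨hu1, hpu, hu0, hu0'⟩ <;>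
  rcases pos_cases L hpos hv with ⟨hv1, hpv, hv0, hv0'⟩ | ⟨hv1, hpv, hv0, hv0'⟩
  · -- bottom to bottom: the run of row `0` from column `u 0` to column `v 0`
    obtain ⟨W, hW⟩ :=
      exists_ladderRowWalk L (j := 0) le_rfl zero_le_one hu0 (by omega : u 0 ≤ v 0) hv0'
    have eu : st (u 0) 0 = u := site_eq_of_coord_eq (st_zero _ _) ((st_one _ _).trans hu1.symm)
    have ev : st (v 0) 0 = v := site_eq_of_coord_eq (st_zero _ _) ((st_one _ _).trans hv1.symm)
    refine ⟨W.copy eu ev, fun z hz => ?_⟩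
    rw [SimpleGraph.Walk.support_copy] at hz
    obtain ⟨hz1, hz0, hz0'⟩ := hW z hz
    rw [hpos z, if_pos hz1]
    omega
  · -- bottom to top: row `0` up to `(L,0)`, the right rung, row `1` back to column `v 0`
    obtain ⟨W₁, hW₁⟩ := exists_ladderRowWalk L (j := 0) le_rfl zero_le_one hu0 hu0' le_rfl
    obtain ⟨W₂, hW₂⟩ := exists_ladderRowWalk L (j := 1) zero_le_one le_rfl hv0 hv0' le_rfl
    have eu : st (u 0) 0 = u := site_eq_of_coord_eq (st_zero _ _) ((st_one _ _).trans hu1.symm)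
    have ev : st (v 0) 1 = v := site_eq_of_coord_eq (st_zero _ _) ((st_one _ _).trans hv1.symm)
    refine ⟨((W₁.concat (ladder_rung_adj L (Nat.cast_nonneg L) le_rfl)).append W₂.reverse).copy eu ev,
      fun z hz => ?_⟩
    rw [SimpleGraph.Walk.support_copy, SimpleGraph.Walk.mem_support_append_iff,
      SimpleGraph.Walk.support_concat, List.mem_append, List.mem_singleton,
      SimpleGraph.Walk.support_reverse, List.mem_reverse] at hz
    rcases hz with (hz | rfl) | hz
    · obtain ⟨hz1, hz0, hz0'⟩ := hW₁ z hz
      rw [hpos z, if_pos hz1]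
      omega
    · rw [hpos (st L 1), st_one, st_zero, if_neg one_ne_zero]
      omega
    · obtain ⟨hz1, hz0, hz0'⟩ := hW₂ z hz
      rw [hpos z, if_neg (by omega)]
      omega
  · -- top to bottom is impossible: top positions exceed bottom positions
    exfalso
    omega
  · -- top to top: the run of row `1` from column `v 0` to column `u 0`, reversed
    obtain ⟨W, hW⟩ :=
      exists_ladderRowWalk L (j := 1) zero_le_one le_rfl hv0 (by omega : v 0 ≤ u 0) hu0'
    have eu : st (u 0) 1 = u := site_eq_of_coord_eq (st_zero _ _) ((st_one _ _).trans hu1.symm)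
    have ev : st (v 0) 1 = v := site_eq_of_coord_eq (st_zero _ _) ((st_one _ _).trans hv1.symm)
    refine ⟨W.reverse.copy eu ev, fun z hz => ?_⟩
    rw [SimpleGraph.Walk.support_copy, SimpleGraph.Walk.support_reverse, List.mem_reverse] at hz
    obtain ⟨hz1, hz0, hz0'⟩ := hW z hz
    rw [hpos z, if_neg (by omega)]
    omega

/-- **Wrap-around boundary arc.** For ladder sites `u`, `v` there is a walk of the ladder graph from
`u` to `v` through the left rung `(0,1) — (0,0)`, visiting only sites with position `≥ pos u` or
`≤ pos v`: the direct arc from `u` up to `(0,1)` (position `2L+1`), the left rung, then the direct arc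
from `(0,0)` (position `0`) to `v`. [folklore] -/
private theorem exists_wrapWalk (L : ℕ) {pos : Site 2 → ℤ}
    (hpos : ∀ p, pos p = if p 1 = 0 then p 0 else 2 * L + 1 - p 0) {u v : Site 2}
    (hu : u ∈ rectSites L 1) (hv : v ∈ rectSites L 1) :
    ∃ W : (discreteDomainGraph (rectDomain L 1) 1).Walk u v,
      ∀ z ∈ W.support, pos u ≤ pos z ∨ pos z ≤ pos v := by
  have htop : st 0 1 ∈ rectSites L 1 := by rw [mem_rectSites_iff, st_zero, st_one]; omega
  have hbot : st 0 0 ∈ rectSites L 1 := by rw [mem_rectSites_iff, st_zero, st_one]; omega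
  have ptop : pos (st 0 1) = 2 * L + 1 := by
    rw [hpos, st_one, st_zero, if_neg one_ne_zero, sub_zero]
  have pbot : pos (st 0 0) = 0 := by rw [hpos, st_one, st_zero, if_pos rfl]
  have hu' : pos u ≤ pos (st 0 1) := by
    rw [ptop]
    rcases pos_cases L hpos hu with ⟨-, hpu, -, hu0'⟩ | ⟨-, hpu, hu0, -⟩ <;> omega
  have hv' : pos (st 0 0) ≤ pos v := by
    rw [pbot]
    rcases pos_cases L hpos hv with ⟨-, hpv, hv0, -⟩ | ⟨-, hpv, -, hv0'⟩ <;> omega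
  obtain ⟨W₁, hW₁⟩ := exists_arcWalk L hpos hu htop hu'
  obtain ⟨W₂, hW₂⟩ := exists_arcWalk L hpos hbot hv hv'
  have hrung : (discreteDomainGraph (rectDomain L 1) 1).Adj (st 0 1) (st 0 0) :=
    (ladder_rung_adj L le_rfl (Nat.cast_nonneg L)).symm
  refine ⟨(W₁.concat hrung).append W₂, fun z hz => ?_⟩
  rw [SimpleGraph.Walk.mem_support_append_iff, SimpleGraph.Walk.support_concat, List.mem_append,
    List.mem_singleton] at hz
  rcases hz with (hz | rfl) | hz
  · exact Or.inl (hW₁ z hz).1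
  · exact Or.inr (by rw [pbot]; omega)
  · exact Or.inr (hW₂ z hz).2

/-- The direct boundary arc between two ladder sites with distinct positions, in either order: a walk
visiting only positions in `[min, max]` of the two positions. [folklore] -/
private theorem exists_arcWalk_of_ne (L : ℕ) {pos : Site 2 → ℤ}
    (hpos : ∀ p, pos p = if p 1 = 0 then p 0 else 2 * L + 1 - p 0) {u v : Site 2}
    (hu : u ∈ rectSites L 1) (hv : v ∈ rectSites L 1) (huv : pos u ≠ pos v) :
    ∃ W : (discreteDomainGraph (rectDomain L 1) 1).Walk u v,
      ∀ z ∈ W.support, min (pos u) (pos v) ≤ pos z ∧ pos z ≤ max (pos u) (pos v) := by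
  rcases lt_or_gt_of_ne huv with h | h
  · obtain ⟨W, hW⟩ := exists_arcWalk L hpos hu hv h.le
    exact ⟨W, fun z hz => by have := hW z hz; omega⟩
  · obtain ⟨W, hW⟩ := exists_arcWalk L hpos hv hu h.le
    refine ⟨W.reverse, fun z hz => ?_⟩
    rw [SimpleGraph.Walk.support_reverse, List.mem_reverse] at hz
    have := hW z hz
    omega

/-- The wrap-around boundary arc between two ladder sites with distinct positions, in either order:
a walk visiting only positions `≥ max` or `≤ min` of the two positions. [folklore] -/
private theorem exists_wrapWalk_of_ne (L : ℕ) {pos : Site 2 → ℤ}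
    (hpos : ∀ p, pos p = if p 1 = 0 then p 0 else 2 * L + 1 - p 0) {u v : Site 2}
    (hu : u ∈ rectSites L 1) (hv : v ∈ rectSites L 1) (huv : pos u ≠ pos v) :
    ∃ W : (discreteDomainGraph (rectDomain L 1) 1).Walk u v,
      ∀ z ∈ W.support, max (pos u) (pos v) ≤ pos z ∨ pos z ≤ min (pos u) (pos v) := by
  rcases lt_or_gt_of_ne huv with h | h
  · obtain ⟨W, hW⟩ := exists_wrapWalk L hpos hv hu
    refine ⟨W.reverse, fun z hz => ?_⟩
    rw [SimpleGraph.Walk.support_reverse, List.mem_reverse] at hz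
    have := hW z hz
    omega
  · obtain ⟨W, hW⟩ := exists_wrapWalk L hpos hu hv
    exact ⟨W, fun z hz => by have := hW z hz; omega⟩

/-! ### The registered stub -/

/-- **Tool stub `stub_ladder_alternate`.** On the ladder `{0..L}×{0,1}` every vertex lies on the
boundary cycle; index it by the position `c` for `(c,0)` and `2L+1-c` for `(c,1)` (counter-clockwise
from `(0,0)`). If four pairwise distinct sites of the ladder are interlaced (every self-avoiding path
`p₁ → p₃` meets every self-avoiding path `p₂ → p₄`), then the pairs `{p₁,p₃}` and `{p₂,p₄}` ALTERNATE
along the cycle: exactly one of the positions of `p₂`, `p₄` lies strictly between the positions of `p₁`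
and `p₃` (otherwise two boundary arcs carry vertex-disjoint paths `p₁ → p₃` and `p₂ → p₄`).
[folklore] -/
theorem stub_ladder_alternate (L : ℕ) {p₁ p₂ p₃ p₄ : Site 2}
    (hp₁ : p₁ ∈ rectSites L 1) (hp₂ : p₂ ∈ rectSites L 1) (hp₃ : p₃ ∈ rectSites L 1) (hp₄ : p₄ ∈ rectSites L 1)
    (h₁₂ : p₁ ≠ p₂) (h₁₃ : p₁ ≠ p₃) (h₁₄ : p₁ ≠ p₄) (h₂₃ : p₂ ≠ p₃) (h₂₄ : p₂ ≠ p₄) (h₃₄ : p₃ ≠ p₄)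
    (hI : Interlaced (discreteDomainGraph (rectDomain L 1) 1) p₁ p₂ p₃ p₄) :
    let pos : Site 2 → ℤ := fun p => if p 1 = 0 then p 0 else 2 * L + 1 - p 0;
    (min (pos p₁) (pos p₃) < pos p₂ ∧ pos p₂ < max (pos p₁) (pos p₃)) ↔
      ¬ (min (pos p₁) (pos p₃) < pos p₄ ∧ pos p₄ < max (pos p₁) (pos p₃)) := by
  intro pos
  have hpos : ∀ p, pos p = if p 1 = 0 then p 0 else 2 * L + 1 - p 0 := fun _ => rfl
  clear_value pos
  -- pairwise distinct ladder sites have pairwise distinct positions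
  have n₁₂ : pos p₁ ≠ pos p₂ := fun h => h₁₂ (eq_of_pos_eq L hpos hp₁ hp₂ h)
  have n₁₃ : pos p₁ ≠ pos p₃ := fun h => h₁₃ (eq_of_pos_eq L hpos hp₁ hp₃ h)
  have n₁₄ : pos p₁ ≠ pos p₄ := fun h => h₁₄ (eq_of_pos_eq L hpos hp₁ hp₄ h)
  have n₂₃ : pos p₂ ≠ pos p₃ := fun h => h₂₃ (eq_of_pos_eq L hpos hp₂ hp₃ h)
  have n₂₄ : pos p₂ ≠ pos p₄ := fun h => h₂₄ (eq_of_pos_eq L hpos hp₂ hp₄ h)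
  have n₃₄ : pos p₃ ≠ pos p₄ := fun h => h₃₄ (eq_of_pos_eq L hpos hp₃ hp₄ h)
  -- interlacing forbids a walk `p₁ → p₃` and a walk `p₂ → p₄` with disjoint supports
  have key : ∀ (P : (discreteDomainGraph (rectDomain L 1) 1).Walk p₁ p₃)
      (Q : (discreteDomainGraph (rectDomain L 1) 1).Walk p₂ p₄),
      (∀ z ∈ P.support, z ∈ Q.support → False) → False := by
    intro P Q h
    obtain ⟨v, hvP, hvQ⟩ := hI P.toPath Q.toPath
    exact h v (P.support_toPath_subset_support hvP) (Q.support_toPath_subset_support hvQ)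
  constructor
  · -- (a) both strictly between: wrap-around arc `p₁ → p₃` against direct arc `p₂ → p₄`
    rintro ⟨h₂m, h₂M⟩ ⟨h₄m, h₄M⟩
    obtain ⟨P, hP⟩ := exists_wrapWalk_of_ne L hpos hp₁ hp₃ n₁₃
    obtain ⟨Q, hQ⟩ := exists_arcWalk_of_ne L hpos hp₂ hp₄ n₂₄
    exact key P Q fun z hzP hzQ => by have := hP z hzP; have := hQ z hzQ; omega
  · -- (b) neither strictly between: direct arc `p₁ → p₃` against an arc `p₂ → p₄` in the complement
    intro h₄
    by_contra h₂
    obtain ⟨P, hP⟩ := exists_arcWalk_of_ne L hpos hp₁ hp₃ n₁₃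
    -- `p₂` and `p₄` lie outside `[m, M]`, their positions differing from those of `p₁`, `p₃`
    have c₂ : pos p₂ < min (pos p₁) (pos p₃) ∨ max (pos p₁) (pos p₃) < pos p₂ := by
      rcases lt_or_gt_of_ne n₁₂ with h | h <;> rcases lt_or_gt_of_ne n₂₃ with h' | h' <;> omega
    have c₄ : pos p₄ < min (pos p₁) (pos p₃) ∨ max (pos p₁) (pos p₃) < pos p₄ := by
      rcases lt_or_gt_of_ne n₁₄ with h | h <;> rcases lt_or_gt_of_ne n₃₄ with h' | h' <;> omega
    obtain ⟨Q, hQ⟩ : ∃ Q : (discreteDomainGraph (rectDomain L 1) 1).Walk p₂ p₄,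
        ∀ z ∈ Q.support, pos z < min (pos p₁) (pos p₃) ∨ max (pos p₁) (pos p₃) < pos z := by
      rcases c₂ with c₂ | c₂ <;> rcases c₄ with c₄ | c₄
      · -- both below `m`: the direct arc between them
        obtain ⟨W, hW⟩ := exists_arcWalk_of_ne L hpos hp₂ hp₄ n₂₄
        exact ⟨W, fun z hz => by have := hW z hz; omega⟩
      · -- `p₂` below `m`, `p₄` above `M`: through the left rung
        obtain ⟨W, hW⟩ := exists_wrapWalk_of_ne L hpos hp₂ hp₄ n₂₄
        exact ⟨W, fun z hz => by have := hW z hz; omega⟩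
      · -- `p₂` above `M`, `p₄` below `m`: through the left rung
        obtain ⟨W, hW⟩ := exists_wrapWalk_of_ne L hpos hp₂ hp₄ n₂₄
        exact ⟨W, fun z hz => by have := hW z hz; omega⟩
      · -- both above `M`: the direct arc between them
        obtain ⟨W, hW⟩ := exists_arcWalk_of_ne L hpos hp₂ hp₄ n₂₄
        exact ⟨W, fun z hz => by have := hW z hz; omega⟩
    exact key P Q fun z hzP hzQ => by have := hP z hzP; have := hQ z hzQ; omega

end Summit.CriticalPhenomena.SAWScalingLimit.Theorems.BoundaryTP2
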